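import Mathlib.Analysis.InnerProductSpace.PiL2
import Mathlib.Analysis.InnerProductSpace.Calculus
import Mathlib.MeasureTheory.Integral.IntervalIntegral.FundThmCalculus
import Mathlib.Tactic.NoncommRing
import HarnessLib

/-!
# Ladder (shift) operators on `ℓ²` of a finite box, the discrete Heisenberg identity, and the
# energy identity of the hopping–damping generator

Finite-dimensional operator algebra on the state space `St V n = ℓ²({0,…,n}; V)`
(`PiLp 2 (fun _ : Fin (n+1) => V)`, `V` a finite-dimensional complex inner-product space), all
operators bounded (`St V n →L[ℂ] St V n`):

* §1  `lower` = the lowering shift `S`, `(S y)_k = y_{k+1}` (`0` at the last site); `raise` = the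
  raising shift `S*`, `(S* y)_k = y_{k−1}` (`0` at the first site); `diag c` = multiplication by a real
  diagonal; `index k₀ = diag (k ↦ k₀ + k)` = the position operator `K` with integer labels
  `k₀, …, k₀ + n`; `siteProj k`; the hopping operators `hopM = S + S*` (`M`) and `hopJ = S − S*` (`J`).
  These are Teschl's shift expressions `S^±` (Jacobi operators, §1.1 (1.8)) cut off to a finite box.
* §2  pointwise formulas (`simp` lemmas).
* §3  THE ALGEBRA: `S S* = 1 − P_last`, `S* S = 1 − P_first` (`lower_comp_raise`, `raise_comp_lower`);
  the commutator table with the index operator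
  `[K, S] = −S`, `[K, S*] = S*`, `[K, M] = −J`, `[K, J] = −M`
  (`index_comp_lower_sub`, `index_comp_raise_sub`, `index_comp_hopM_sub`, `index_comp_hopJ_sub`);
  `M² − J² = 2(S S* + S* S) = 4·1 − 2(P_first + P_last)` (`hopM_sq_sub_hopJ_sq(_eq)`).
* §4  ADJOINTS AND FORMS: `⟪S y, z⟫ = ⟪y, S* z⟫`, `M` symmetric, `J` skew, real diagonals symmetric with
  `⟪diag c y, y⟫ = Σ c_k‖y_k‖²`, `⟪M y, y⟫ ∈ ℝ`; `‖S y‖² = ‖y‖² − ‖y_0‖²`, `‖S* y‖² = ‖y‖² − ‖y_n‖²`,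
  `‖S‖, ‖S*‖ ≤ 1`, `‖M‖, ‖J‖ ≤ 2`;
  `‖y‖² = ¼(‖M y‖² + ‖J y‖²) + ½(‖y_0‖² + ‖y_n‖²)` (`norm_sq_eq_quarter`, parallelogram law);
  the DISCRETE HEISENBERG IDENTITY (summation by parts against the labels, Teschl (1.18))
  `2‖y‖² = −Re⟪K J y, M y⟫ + (1 − k₀)‖y_0‖² + (1 + k₀ + n)‖y_n‖²` (`two_mul_norm_sq_eq`), and the
  UNCERTAINTY INEQUALITY with explicit boundary terms (`norm_sq_le_uncertainty`): for every `ρ > 0`,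
  `‖y‖² ≤ ((1 + ρ⁻¹)/2)‖J y‖² + (ρ/2)‖K y‖² + ½((1 − k₀)‖y_0‖² + (1 + k₀ + n)‖y_n‖²)`
  — the finite-dimensional counterpart of the bracket `[∂_y, u(y)∂ₓ] = u′∂ₓ` driving the
  hypocoercivity functionals of Bedrossian–Coti Zelati (ARMA 224 (2017), §2): here `K ↔ −i∂_p`,
  `M ↔ 2cos p`, `J ↔ 2i sin p`.
* §5  THE GENERATOR `gen d h = D − i h M` of the ladder evolution `y′ = −H y = (i h M − D) y`
  (relaxation enhancement by a skew hopping on top of a damping, Constantin–Kiselev–Ryzhik–Zlatoš,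
  Ann. Math. 168 (2008), (1.1) `φₜ + A u·∇φ = Δφ`): `Re⟪H v, v⟫ = Σ d_k‖v_k‖²` (also with a spectral
  shift `iμ`), hence ACCRETIVITY for `d ≥ 0` — the hypothesis `hacc` of the finite-dimensional
  Gearhart–Prüss/Wei bound `Literature.Analysis.OperatorTheory.norm_le_exp_pi_mul_of_resolvent_bound`
  (`GearhartPrussAccretive.lean`) — and the ENERGY IDENTITY
  `‖u t‖² + 2∫ₐᵗ Σ_k d_k‖u_k(s)‖² ds = ‖u a‖²` for `u′ = −H u` on `[a, b]` in the `HasDerivWithinAt (Icc a b)`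
  shape of that file (`norm_sq_add_two_mul_integral_eq`).

All statements are elementary finite-dimensional algebra / calculus; the citations locate the notions
(Teschl) and the context in which these identities are used (BCZ 2017 §2, CKRZ 2008, Wei 2021).
Consumer: cell `ad-ideate`, K1L_D `stmt-AnomalousDissipation-27980`, lane R3′ «SidebandTailCrushing»
(ruling D28-16: crushing lemma (M3-a) hypocoercivity on the ladder / (M3-b) resolvent + Wei).

## Mathlib / tree search
Mathlib has `PiLp`, `Fin.snoc`/`Fin.cons`, `parallelogram_law_with_norm`, the FTC
`intervalIntegral.integral_eq_sub_of_hasDerivAt_of_le`, `HasDerivAt.inner`; no shift/ladder operator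
algebra on finite boxes. Tree: `GearhartPrussAccretive` (Wei's theorem, finite dimension),
`ResolventEnergyInequality`, `KolmogorovShearResolvent` (the continuum shear analogue).

## References
* G. Teschl, *Jacobi Operators and Completely Integrable Nonlinear Lattices*, AMS Math. Surveys
  Monogr. 72 (2000), §1.1: (1.4) `ℓ²(I, M)`, (1.8) shift expressions `S^±`, (1.9), (1.13), (1.15)
  `∂, ∂*` formally adjoint, (1.17)–(1.18) product rule and summation by parts. [`Teschl1999`]
* J. Bedrossian, M. Coti Zelati, Arch. Ration. Mech. Anal. 224 (2017), §2. [`BedrossianCotiZelati2017`]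
* P. Constantin, A. Kiselev, L. Ryzhik, A. Zlatoš, Ann. of Math. 168 (2008) 643–674, §1.
  [`ConstantinEtAl2008`]
* D. Wei, Sci. China Math. 64 (2021), Thm. 1.3. [`Wei2019`]
-/

noncomputable section

open scoped InnerProductSpace ComplexConjugate
open Complex Set MeasureTheory intervalIntegral Finset

namespace Literature.Analysis.OperatorTheory

namespace Ladder

variable {V : Type*} [NormedAddCommGroup V] [InnerProductSpace ℂ V] [FiniteDimensional ℂ V] {n : ℕ}

/-- The state space `ℓ²({0,…,n}; V)` of the finite box with `n + 1` sites and values in `V`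
(Teschl's `ℓ²(I, M)`, (1.4)). [cite: Teschl1999, §1.1 eq. (1.4)] -/
abbrev St (V : Type*) [NormedAddCommGroup V] [InnerProductSpace ℂ V] (n : ℕ) : Type _ :=
  PiLp 2 (fun _ : Fin (n + 1) => V)

/-! ## §1 The operators -/

section Defs

variable (V n)

/-- The LOWERING shift `(S y)_k = y_{k+1}` (`= 0` at the last site), as a linear map
(Teschl's `S⁺`, (1.8), cut off to the box). [cite: Teschl1999, §1.1 eq. (1.8)] -/
def lowerₗ : St V n →ₗ[ℂ] St V n where
  toFun y := WithLp.toLp 2 (Fin.snoc (α := fun _ : Fin (n + 1) => V) (fun j : Fin n => y j.succ) 0)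
  map_add' y z := by
    refine PiLp.ext fun k => ?_
    refine Fin.lastCases ?_ (fun j => ?_) k
    · simp [Fin.snoc_last]
    · simp [Fin.snoc_castSucc]
  map_smul' c y := by
    refine PiLp.ext fun k => ?_
    refine Fin.lastCases ?_ (fun j => ?_) k
    · simp [Fin.snoc_last]
    · simp [Fin.snoc_castSucc]

/-- The RAISING shift `(S* y)_k = y_{k-1}` (`= 0` at the first site), as a linear map
(Teschl's `S⁻`, (1.8), cut off to the box). [cite: Teschl1999, §1.1 eq. (1.8)] -/
def raiseₗ : St V n →ₗ[ℂ] St V n where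
  toFun y := WithLp.toLp 2 (Fin.cons (α := fun _ : Fin (n + 1) => V) 0 (fun j : Fin n => y j.castSucc))
  map_add' y z := by
    refine PiLp.ext fun k => ?_
    refine Fin.cases ?_ (fun j => ?_) k
    · simp [Fin.cons_zero]
    · simp [Fin.cons_succ]
  map_smul' c y := by
    refine PiLp.ext fun k => ?_
    refine Fin.cases ?_ (fun j => ?_) k
    · simp [Fin.cons_zero]
    · simp [Fin.cons_succ]

/-- Multiplication by a REAL diagonal `(diag c y)_k = c_k • y_k`, as a linear map (a multiplication
expression, Teschl (1.9)). [cite: Teschl1999, §1.1 eq. (1.9)] -/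
def diagₗ (c : Fin (n + 1) → ℝ) : St V n →ₗ[ℂ] St V n where
  toFun y := WithLp.toLp 2 (fun k => ((c k : ℝ) : ℂ) • y k)
  map_add' y z := by
    refine PiLp.ext fun k => ?_
    simp [smul_add]
  map_smul' a y := by
    refine PiLp.ext fun k => ?_
    simp [smul_comm a]

/-- The lowering shift `S` as a bounded operator on `ℓ²({0,…,n}; V)`. [cite: Teschl1999, §1.1 eq. (1.8)] -/
def lower : St V n →L[ℂ] St V n := LinearMap.toContinuousLinearMap (lowerₗ V n)

/-- The raising shift `S*` as a bounded operator on `ℓ²({0,…,n}; V)`. [cite: Teschl1999, §1.1 eq. (1.8)] -/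
def raise : St V n →L[ℂ] St V n := LinearMap.toContinuousLinearMap (raiseₗ V n)

/-- The real diagonal multiplication operator `diag c`. [cite: Teschl1999, §1.1 eq. (1.9)] -/
def diag (c : Fin (n + 1) → ℝ) : St V n →L[ℂ] St V n := LinearMap.toContinuousLinearMap (diagₗ V n c)

/-- The INDEX (position) operator with integer labels `k₀, k₀ + 1, …, k₀ + n`:
`(K y)_k = (k₀ + k) • y_k`. [cite: Teschl1999, §1.1 eq. (1.9)] -/
def index (k₀ : ℤ) : St V n →L[ℂ] St V n := diag V n (fun k => (k₀ : ℝ) + k)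

/-- The projection onto the site `k`: `(P_k y)_j = y_j` if `j = k`, else `0`. [cite: Teschl1999, §1.1 eq. (1.7)] -/
def siteProj (k : Fin (n + 1)) : St V n →L[ℂ] St V n := diag V n (fun j => if j = k then 1 else 0)

/-- The symmetric HOPPING operator `M = S + S*`: `(M y)_k = y_{k+1} + y_{k-1}` (the off-diagonal part of
a Jacobi operator with `a ≡ 1`, Teschl (1.13)). [cite: Teschl1999, §1.1 eq. (1.13)] -/
def hopM : St V n →L[ℂ] St V n := lower V n + raise V n

/-- The skew hopping operator `J = S − S*`: `(J y)_k = y_{k+1} − y_{k-1}` (twice the symmetric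
difference; `∂ − ∂*` in Teschl (1.15)). [cite: Teschl1999, §1.1 eq. (1.15)] -/
def hopJ : St V n →L[ℂ] St V n := lower V n - raise V n

end Defs

/-! ## §2 Pointwise formulas -/

section Apply

variable (y : St V n)

/-- `(S y)_k = y_{k+1}` away from the last site. [cite: Teschl1999, §1.1 eq. (1.8)] -/
@[simp] theorem lower_apply_castSucc (j : Fin n) : lower V n y j.castSucc = y j.succ := by
  simp [lower, lowerₗ, Fin.snoc_castSucc]

/-- `(S y)_{last} = 0` (cut-off). [cite: Teschl1999, §1.1 eq. (1.8)] -/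
@[simp] theorem lower_apply_last : lower V n y (Fin.last n) = 0 := by
  simp [lower, lowerₗ, Fin.snoc_last]

/-- `(S* y)_0 = 0` (cut-off). [cite: Teschl1999, §1.1 eq. (1.8)] -/
@[simp] theorem raise_apply_zero : raise V n y 0 = 0 := by
  simp [raise, raiseₗ, Fin.cons_zero]

/-- `(S* y)_{k+1} = y_k`. [cite: Teschl1999, §1.1 eq. (1.8)] -/
@[simp] theorem raise_apply_succ (j : Fin n) : raise V n y j.succ = y j.castSucc := by
  simp [raise, raiseₗ, Fin.cons_succ]

/-- `(diag c y)_k = c_k • y_k`. [cite: Teschl1999, §1.1 eq. (1.9)] -/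
@[simp] theorem diag_apply (c : Fin (n + 1) → ℝ) (k : Fin (n + 1)) : diag V n c y k = ((c k : ℝ) : ℂ) • y k := by
  simp [diag, diagₗ]

/-- `(K y)_k = (k₀ + k) • y_k`. [cite: Teschl1999, §1.1 eq. (1.9)] -/
theorem index_apply (k₀ : ℤ) (k : Fin (n + 1)) : index V n k₀ y k = (((k₀ : ℝ) + k : ℝ) : ℂ) • y k := by
  simp [index]

/-- `(P_k y)_j = y_j` if `j = k`, else `0`. [cite: Teschl1999, §1.1 eq. (1.7)] -/
theorem siteProj_apply (k j : Fin (n + 1)) : siteProj V n k y j = if j = k then y j else 0 := by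
  rw [siteProj, diag_apply]
  split_ifs <;> simp

/-- `(M y)_k = (S y)_k + (S* y)_k`. [cite: Teschl1999, §1.1 eq. (1.13)] -/
theorem hopM_apply (k : Fin (n + 1)) : hopM V n y k = lower V n y k + raise V n y k := by
  simp [hopM]

/-- `(J y)_k = (S y)_k − (S* y)_k`. [cite: Teschl1999, §1.1 eq. (1.15)] -/
theorem hopJ_apply (k : Fin (n + 1)) : hopJ V n y k = lower V n y k - raise V n y k := by
  simp [hopJ]

end Apply

/-! ## §3 The operator algebra: `S S* = 1 − P_last`, `S* S = 1 − P_first`, the commutator table with the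
index operator, and `M² − J² = 4·1 − 2(P_first + P_last)` -/

section Algebra

/-- `S S* = 1 − P_{last}` on the box (on `ℓ²(ℤ)` one has `S⁺S⁻ = 1`, Teschl (1.9): `(S^±)⁻¹ = S^∓`;
the cut-off loses the last site). [cite: Teschl1999, §1.1 eq. (1.9)] -/
theorem lower_comp_raise : lower V n ∘L raise V n = 1 - siteProj V n (Fin.last n) := by
  refine ContinuousLinearMap.ext fun y => PiLp.ext fun k => ?_
  rw [ContinuousLinearMap.comp_apply, sub_apply, one_apply_eq_self,
    PiLp.sub_apply, siteProj_apply]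
  refine Fin.lastCases ?_ (fun j => ?_) k
  · simp
  · rw [lower_apply_castSucc, raise_apply_succ, if_neg (Fin.castSucc_lt_last j).ne, sub_zero]

/-- `S* S = 1 − P_{first}` on the box. [cite: Teschl1999, §1.1 eq. (1.9)] -/
theorem raise_comp_lower : raise V n ∘L lower V n = 1 - siteProj V n 0 := by
  refine ContinuousLinearMap.ext fun y => PiLp.ext fun k => ?_
  rw [ContinuousLinearMap.comp_apply, sub_apply, one_apply_eq_self,
    PiLp.sub_apply, siteProj_apply]
  refine Fin.cases ?_ (fun j => ?_) k
  · simp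
  · rw [raise_apply_succ, lower_apply_castSucc, if_neg (Fin.succ_ne_zero j), sub_zero]

/-- **Commutator with the index operator, lowering**: `[K, S] = −S`. [cite: Teschl1999, §1.1 eq. (1.17)] -/
theorem index_comp_lower_sub (k₀ : ℤ) :
    index V n k₀ ∘L lower V n - lower V n ∘L index V n k₀ = -lower V n := by
  refine ContinuousLinearMap.ext fun y => PiLp.ext fun k => ?_
  rw [sub_apply, neg_apply, PiLp.sub_apply, PiLp.neg_apply,
    ContinuousLinearMap.comp_apply, ContinuousLinearMap.comp_apply, index_apply]
  refine Fin.lastCases ?_ (fun j => ?_) k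
  · simp
  · rw [lower_apply_castSucc, lower_apply_castSucc, index_apply, ← sub_smul, ← Complex.ofReal_sub,
      Fin.val_castSucc, Fin.val_succ]
    push_cast
    ring_nf
    simp

/-- **Commutator with the index operator, raising**: `[K, S*] = S*`. [cite: Teschl1999, §1.1 eq. (1.17)] -/
theorem index_comp_raise_sub (k₀ : ℤ) :
    index V n k₀ ∘L raise V n - raise V n ∘L index V n k₀ = raise V n := by
  refine ContinuousLinearMap.ext fun y => PiLp.ext fun k => ?_
  rw [sub_apply, PiLp.sub_apply, ContinuousLinearMap.comp_apply,
    ContinuousLinearMap.comp_apply, index_apply]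
  refine Fin.cases ?_ (fun j => ?_) k
  · simp
  · rw [raise_apply_succ, raise_apply_succ, index_apply, ← sub_smul, ← Complex.ofReal_sub,
      Fin.val_castSucc, Fin.val_succ]
    push_cast
    ring_nf
    simp

/-- `[K, M] = −J`. [cite: Teschl1999, §1.1 eq. (1.17)] -/
theorem index_comp_hopM_sub (k₀ : ℤ) :
    index V n k₀ ∘L hopM V n - hopM V n ∘L index V n k₀ = -hopJ V n := by
  have h1 := index_comp_lower_sub (V := V) (n := n) k₀
  have h2 := index_comp_raise_sub (V := V) (n := n) k₀
  simp only [hopM, hopJ, ContinuousLinearMap.comp_add, ContinuousLinearMap.add_comp]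
  rw [show index V n k₀ ∘L lower V n + index V n k₀ ∘L raise V n - (lower V n ∘L index V n k₀ + raise V n ∘L index V n k₀)
      = (index V n k₀ ∘L lower V n - lower V n ∘L index V n k₀) + (index V n k₀ ∘L raise V n - raise V n ∘L index V n k₀)
      by abel, h1, h2]
  abel

/-- `[K, J] = −M`. [cite: Teschl1999, §1.1 eq. (1.17)] -/
theorem index_comp_hopJ_sub (k₀ : ℤ) :
    index V n k₀ ∘L hopJ V n - hopJ V n ∘L index V n k₀ = -hopM V n := by
  have h1 := index_comp_lower_sub (V := V) (n := n) k₀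
  have h2 := index_comp_raise_sub (V := V) (n := n) k₀
  simp only [hopM, hopJ, ContinuousLinearMap.comp_sub, ContinuousLinearMap.sub_comp]
  rw [show index V n k₀ ∘L lower V n - index V n k₀ ∘L raise V n - (lower V n ∘L index V n k₀ - raise V n ∘L index V n k₀)
      = (index V n k₀ ∘L lower V n - lower V n ∘L index V n k₀) - (index V n k₀ ∘L raise V n - raise V n ∘L index V n k₀)
      by abel, h1, h2]
  abel

/-- `M² − J² = 2 (S S* + S* S)` (ring identity). [cite: Teschl1999, §1.1 eq. (1.9)] -/
theorem hopM_sq_sub_hopJ_sq :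
    hopM V n ∘L hopM V n - hopJ V n ∘L hopJ V n =
      (lower V n ∘L raise V n + raise V n ∘L lower V n) + (lower V n ∘L raise V n + raise V n ∘L lower V n) := by
  simp only [hopM, hopJ, ContinuousLinearMap.comp_add, ContinuousLinearMap.add_comp, ContinuousLinearMap.comp_sub,
    ContinuousLinearMap.sub_comp]
  abel

/-- **`M² − J² = 4·1 − 2 (P_first + P_last)`** on the box with `n + 1` sites. [cite: Teschl1999, §1.1 eq. (1.9)] -/
theorem hopM_sq_sub_hopJ_sq_eq :
    hopM V n ∘L hopM V n - hopJ V n ∘L hopJ V n =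
      4 • (1 : St V n →L[ℂ] St V n) - 2 • (siteProj V n 0 + siteProj V n (Fin.last n)) := by
  rw [hopM_sq_sub_hopJ_sq, lower_comp_raise, raise_comp_lower]
  abel

end Algebra

/-! ## §4 Adjoints and quadratic forms -/

section Inner

variable (y z : St V n)

/-- **`S` and `S*` are mutually adjoint**: `⟪S y, z⟫ = ⟪y, S* z⟫` (Teschl: `∂`, `∂*` are formally
adjoint, (1.15); on the box there are no boundary terms). [cite: Teschl1999, §1.1 eq. (1.15)] -/
theorem inner_lower_left : ⟪lower V n y, z⟫_ℂ = ⟪y, raise V n z⟫_ℂ := by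
  rw [PiLp.inner_apply, PiLp.inner_apply, Fin.sum_univ_castSucc, Fin.sum_univ_succ]
  simp

/-- `⟪S* y, z⟫ = ⟪y, S z⟫`. [cite: Teschl1999, §1.1 eq. (1.15)] -/
theorem inner_raise_left : ⟪raise V n y, z⟫_ℂ = ⟪y, lower V n z⟫_ℂ := by
  rw [← inner_conj_symm, ← inner_lower_left, inner_conj_symm]

/-- `M` is symmetric: `⟪M y, z⟫ = ⟪y, M z⟫`. [cite: Teschl1999, §1.1 eq. (1.20)] -/
theorem inner_hopM_left : ⟪hopM V n y, z⟫_ℂ = ⟪y, hopM V n z⟫_ℂ := by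
  simp only [hopM, add_apply, inner_add_left, inner_add_right, inner_lower_left,
    inner_raise_left]
  ring

/-- `J` is skew-symmetric: `⟪J y, z⟫ = −⟪y, J z⟫`. [cite: Teschl1999, §1.1 eq. (1.20)] -/
theorem inner_hopJ_left : ⟪hopJ V n y, z⟫_ℂ = -⟪y, hopJ V n z⟫_ℂ := by
  simp only [hopJ, sub_apply, inner_sub_left, inner_sub_right, inner_lower_left,
    inner_raise_left]
  ring

/-- A real diagonal is symmetric: `⟪diag c y, z⟫ = ⟪y, diag c z⟫`. [cite: Teschl1999, §1.1 eq. (1.20)] -/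
theorem inner_diag_left (c : Fin (n + 1) → ℝ) : ⟪diag V n c y, z⟫_ℂ = ⟪y, diag V n c z⟫_ℂ := by
  rw [PiLp.inner_apply, PiLp.inner_apply]
  refine Finset.sum_congr rfl fun k _ => ?_
  rw [diag_apply, diag_apply, inner_smul_left, inner_smul_right, Complex.conj_ofReal]

/-- The quadratic form of a real diagonal: `⟪diag c y, y⟫ = Σ_k c_k ‖y_k‖²` (a real number).
[cite: Teschl1999, §1.1 eq. (1.20)] -/
theorem inner_diag_self (c : Fin (n + 1) → ℝ) :
    ⟪diag V n c y, y⟫_ℂ = ((∑ k, c k * ‖y k‖ ^ 2 : ℝ) : ℂ) := by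
  rw [PiLp.inner_apply, Complex.ofReal_sum]
  refine Finset.sum_congr rfl fun k _ => ?_
  rw [diag_apply, inner_smul_left, Complex.conj_ofReal, inner_self_eq_norm_sq_to_K]
  simp only [Complex.ofReal_mul, Complex.ofReal_pow]
  rfl

/-- `⟪M y, y⟫` is real. [cite: Teschl1999, §1.1 eq. (1.20)] -/
theorem inner_hopM_self_im : (⟪hopM V n y, y⟫_ℂ).im = 0 := by
  -- `conj w = w` ⇒ `im w = 0`
  have h1 : conj ⟪hopM V n y, y⟫_ℂ = ⟪hopM V n y, y⟫_ℂ := by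
    rw [inner_conj_symm]; exact (inner_hopM_left y y).symm
  have := congrArg Complex.im h1
  rw [Complex.conj_im] at this
  linarith

/-- `‖S y‖² = ‖y‖² − ‖y_{first}‖²`. [cite: Teschl1999, §1.1 eq. (1.18)] -/
theorem norm_lower_sq : ‖lower V n y‖ ^ 2 = ‖y‖ ^ 2 - ‖y 0‖ ^ 2 := by
  rw [PiLp.norm_sq_eq_of_L2, PiLp.norm_sq_eq_of_L2, Fin.sum_univ_castSucc,
    Fin.sum_univ_succ (f := fun i => ‖y i‖ ^ 2)]
  simp

/-- `‖S* y‖² = ‖y‖² − ‖y_{last}‖²`. [cite: Teschl1999, §1.1 eq. (1.18)] -/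
theorem norm_raise_sq : ‖raise V n y‖ ^ 2 = ‖y‖ ^ 2 - ‖y (Fin.last n)‖ ^ 2 := by
  rw [PiLp.norm_sq_eq_of_L2, PiLp.norm_sq_eq_of_L2, Fin.sum_univ_succ,
    Fin.sum_univ_castSucc (f := fun i => ‖y i‖ ^ 2)]
  simp

/-- **`‖y‖² = ¼(‖M y‖² + ‖J y‖²) + ½(‖y_{first}‖² + ‖y_{last}‖²)`** — the quadratic-form version of
`M² − J² = 4·1 − 2(P_first + P_last)` (parallelogram law). [cite: Teschl1999, §1.1 eq. (1.18)] -/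
theorem norm_sq_eq_quarter :
    ‖y‖ ^ 2 = (‖hopM V n y‖ ^ 2 + ‖hopJ V n y‖ ^ 2) / 4 + (‖y 0‖ ^ 2 + ‖y (Fin.last n)‖ ^ 2) / 2 := by
  have hpar := parallelogram_law_with_norm ℂ (lower V n y) (raise V n y)
  have e1 : hopM V n y = lower V n y + raise V n y := rfl
  have e2 : hopJ V n y = lower V n y - raise V n y := rfl
  rw [e1, e2]
  have h1 := norm_lower_sq y
  have h2 := norm_raise_sq y
  nlinarith [hpar, h1, h2]

/-- **The discrete Heisenberg identity** (summation by parts against the index labels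
`ℓ_k = k₀ + k`, Teschl (1.18); `y_{-1} = y_{n+1} = 0`):
`2‖y‖² = −Re⟪K J y, M y⟫ + (1 − k₀)‖y_0‖² + (1 + k₀ + n)‖y_n‖²`.
[cite: Teschl1999, §1.1 eq. (1.18)] -/
theorem two_mul_norm_sq_eq (k₀ : ℤ) :
    2 * ‖y‖ ^ 2 = -(⟪index V n k₀ (hopJ V n y), hopM V n y⟫_ℂ).re +
      (1 - k₀) * ‖y 0‖ ^ 2 + (1 + k₀ + n) * ‖y (Fin.last n)‖ ^ 2 := by
  -- `Re⟪(Jy)_k, (My)_k⟫ = ‖(Sy)_k‖² − ‖(S*y)_k‖²`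
  have hre : ∀ a b : V, (⟪a - b, a + b⟫_ℂ).re = ‖a‖ ^ 2 - ‖b‖ ^ 2 := by
    intro a b
    rw [inner_sub_left, inner_add_right, inner_add_right, Complex.sub_re, Complex.add_re, Complex.add_re,
      ← inner_conj_symm b a, Complex.conj_re]
    have e1 : (⟪a, a⟫_ℂ).re = ‖a‖ ^ 2 := by rw [← RCLike.re_to_complex]; exact inner_self_eq_norm_sq (𝕜 := ℂ) a
    have e2 : (⟪b, b⟫_ℂ).re = ‖b‖ ^ 2 := by rw [← RCLike.re_to_complex]; exact inner_self_eq_norm_sq (𝕜 := ℂ) b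
    rw [e1, e2]; ring
  have hsum : (⟪index V n k₀ (hopJ V n y), hopM V n y⟫_ℂ).re =
      ∑ k : Fin (n + 1), ((k₀ : ℝ) + k) * (‖lower V n y k‖ ^ 2 - ‖raise V n y k‖ ^ 2) := by
    rw [PiLp.inner_apply, Complex.re_sum]
    refine Finset.sum_congr rfl fun k _ => ?_
    rw [index_apply, hopJ_apply, hopM_apply, inner_smul_left, Complex.conj_ofReal, Complex.re_ofReal_mul, hre]
  -- the two weighted sums, re-indexed over `Fin (n+1)`
  have hA : ∑ k : Fin (n + 1), ((k₀ : ℝ) + k) * ‖lower V n y k‖ ^ 2 =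
      ∑ i : Fin (n + 1), ((k₀ : ℝ) + i - 1) * ‖y i‖ ^ 2 - ((k₀ : ℝ) - 1) * ‖y 0‖ ^ 2 := by
    rw [Fin.sum_univ_castSucc, Fin.sum_univ_succ (f := fun i : Fin (n + 1) => ((k₀ : ℝ) + i - 1) * ‖y i‖ ^ 2)]
    simp only [lower_apply_castSucc, lower_apply_last, norm_zero, Fin.val_castSucc, Fin.val_succ, Fin.val_zero,
      Nat.cast_zero, Nat.cast_add, Nat.cast_one]
    ring
  have hB : ∑ k : Fin (n + 1), ((k₀ : ℝ) + k) * ‖raise V n y k‖ ^ 2 =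
      ∑ i : Fin (n + 1), ((k₀ : ℝ) + i + 1) * ‖y i‖ ^ 2 - ((k₀ : ℝ) + n + 1) * ‖y (Fin.last n)‖ ^ 2 := by
    rw [Fin.sum_univ_succ, Fin.sum_univ_castSucc (f := fun i : Fin (n + 1) => ((k₀ : ℝ) + i + 1) * ‖y i‖ ^ 2)]
    simp only [raise_apply_zero, raise_apply_succ, norm_zero, Fin.val_castSucc, Fin.val_succ, Fin.val_last,
      Nat.cast_add, Nat.cast_one]
    ring
  have hT : ∑ i : Fin (n + 1), ((k₀ : ℝ) + i - 1) * ‖y i‖ ^ 2 - ∑ i : Fin (n + 1), ((k₀ : ℝ) + i + 1) * ‖y i‖ ^ 2 =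
      -2 * ‖y‖ ^ 2 := by
    rw [PiLp.norm_sq_eq_of_L2, Finset.mul_sum, ← Finset.sum_sub_distrib]
    refine Finset.sum_congr rfl fun i _ => ?_
    ring
  have hsplit : ∑ k : Fin (n + 1), ((k₀ : ℝ) + k) * (‖lower V n y k‖ ^ 2 - ‖raise V n y k‖ ^ 2) =
      ∑ k : Fin (n + 1), ((k₀ : ℝ) + k) * ‖lower V n y k‖ ^ 2 - ∑ k : Fin (n + 1), ((k₀ : ℝ) + k) * ‖raise V n y k‖ ^ 2 := by
    rw [← Finset.sum_sub_distrib]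
    refine Finset.sum_congr rfl fun i _ => ?_
    ring
  rw [hsum, hsplit, hA, hB]
  linear_combination hT

/-- `‖S y‖ ≤ ‖y‖`. [cite: Teschl1999, §1.1 eq. (1.8)] -/
theorem norm_lower_le : ‖lower V n y‖ ≤ ‖y‖ := by
  have h := norm_lower_sq y
  nlinarith [norm_nonneg (lower V n y), norm_nonneg y, norm_nonneg (y 0)]

/-- `‖S* y‖ ≤ ‖y‖`. [cite: Teschl1999, §1.1 eq. (1.8)] -/
theorem norm_raise_le : ‖raise V n y‖ ≤ ‖y‖ := by
  have h := norm_raise_sq y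
  nlinarith [norm_nonneg (raise V n y), norm_nonneg y, norm_nonneg (y (Fin.last n))]

/-- `‖M y‖ ≤ 2‖y‖`. [cite: Teschl1999, §1.1 eq. (1.13)] -/
theorem norm_hopM_le : ‖hopM V n y‖ ≤ 2 * ‖y‖ := by
  have e : hopM V n y = lower V n y + raise V n y := rfl
  rw [e]
  exact (norm_add_le _ _).trans (by linarith [norm_lower_le y, norm_raise_le y])

/-- `‖J y‖ ≤ 2‖y‖`. [cite: Teschl1999, §1.1 eq. (1.15)] -/
theorem norm_hopJ_le : ‖hopJ V n y‖ ≤ 2 * ‖y‖ := by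
  have e : hopJ V n y = lower V n y - raise V n y := rfl
  rw [e]
  exact (norm_sub_le _ _).trans (by linarith [norm_lower_le y, norm_raise_le y])

/-- **The uncertainty inequality of the ladder** (finite-dimensional analogue of the hypocoercivity
bracket `[∂_y, u∂ₓ] = u′∂ₓ` of Bedrossian–Coti Zelati, here `[K, M] = −J`, `[K, J] = −M`): for every
`ρ > 0`,
`‖y‖² ≤ ((1 + ρ⁻¹)/2)‖J y‖² + (ρ/2)‖K y‖² + ((1 − k₀)‖y_0‖² + (1 + k₀ + n)‖y_n‖²)/2`
(from the discrete Heisenberg identity, `⟪KJy, My⟫ = ⟪Jy, MKy⟫ − ‖Jy‖²`, `‖M‖ ≤ 2` and Young).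
[cite: BedrossianCotiZelati2017, §2] -/
theorem norm_sq_le_uncertainty (k₀ : ℤ) {ρ : ℝ} (hρ : 0 < ρ) :
    ‖y‖ ^ 2 ≤ (1 + ρ⁻¹) / 2 * ‖hopJ V n y‖ ^ 2 + ρ / 2 * ‖index V n k₀ y‖ ^ 2 +
      ((1 - k₀) * ‖y 0‖ ^ 2 + (1 + k₀ + n) * ‖y (Fin.last n)‖ ^ 2) / 2 := by
  have hH := two_mul_norm_sq_eq y k₀
  -- `⟪K J y, M y⟫ = ⟪J y, M K y⟫ − ‖J y‖²`
  have hKM : index V n k₀ (hopM V n y) = hopM V n (index V n k₀ y) - hopJ V n y := by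
    have h := congrArg (fun T : St V n →L[ℂ] St V n => T y) (index_comp_hopM_sub (V := V) (n := n) k₀)
    simp only [sub_apply, neg_apply, ContinuousLinearMap.comp_apply] at h
    rw [← sub_eq_zero] at h ⊢
    rw [← h]; abel
  have h1 : ⟪index V n k₀ (hopJ V n y), hopM V n y⟫_ℂ =
      ⟪hopJ V n y, hopM V n (index V n k₀ y)⟫_ℂ - ((‖hopJ V n y‖ : ℂ)) ^ 2 := by
    rw [index, inner_diag_left, ← index, hKM, inner_sub_right, inner_self_eq_norm_sq_to_K]
    rfl
  have h2 : -(⟪index V n k₀ (hopJ V n y), hopM V n y⟫_ℂ).re ≤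
      ‖hopJ V n y‖ ^ 2 + 2 * (‖hopJ V n y‖ * ‖index V n k₀ y‖) := by
    rw [h1, Complex.sub_re]
    have e : (((‖hopJ V n y‖ : ℂ)) ^ 2).re = ‖hopJ V n y‖ ^ 2 := by norm_cast
    rw [e]
    have h3 : |(⟪hopJ V n y, hopM V n (index V n k₀ y)⟫_ℂ).re| ≤ ‖hopJ V n y‖ * ‖hopM V n (index V n k₀ y)‖ :=
      (Complex.abs_re_le_norm _).trans (norm_inner_le_norm _ _)
    have h4 : ‖hopM V n (index V n k₀ y)‖ ≤ 2 * ‖index V n k₀ y‖ := norm_hopM_le _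
    have h5 := neg_abs_le (⟪hopJ V n y, hopM V n (index V n k₀ y)⟫_ℂ).re
    nlinarith [norm_nonneg (hopJ V n y), norm_nonneg (index V n k₀ y)]
  -- Young: `2ab ≤ a²/ρ + ρ b²`
  have hY : 2 * (‖hopJ V n y‖ * ‖index V n k₀ y‖) ≤ ρ⁻¹ * ‖hopJ V n y‖ ^ 2 + ρ * ‖index V n k₀ y‖ ^ 2 := by
    have hsq : 0 ≤ (ρ⁻¹ * ‖hopJ V n y‖ - ‖index V n k₀ y‖) ^ 2 * ρ := by positivity
    have e : (ρ⁻¹ * ‖hopJ V n y‖ - ‖index V n k₀ y‖) ^ 2 * ρ =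
        ρ⁻¹ * ‖hopJ V n y‖ ^ 2 + ρ * ‖index V n k₀ y‖ ^ 2 - 2 * (‖hopJ V n y‖ * ‖index V n k₀ y‖) := by
      field_simp
      ring
    linarith [hsq, e]
  nlinarith [hH, h2, hY]

end Inner

/-! ## §5 The hopping–damping generator `H = D − i h M`: accretivity and the energy identity -/

section Energy

/-- The generator `H = D − i h M` of the ladder evolution `y′ = −H y = (i h M − D) y` (real damping
diagonal `d`, real hopping amplitude `h`). [cite: ConstantinEtAl2008, §1 eq. (1.1)] -/
def gen (d : Fin (n + 1) → ℝ) (h : ℝ) : St V n →L[ℂ] St V n :=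
  diag V n d - ((h : ℂ) * I) • hopM V n

/-- `gen d h v = diag d v − (h i) • M v`. [cite: ConstantinEtAl2008, §1 eq. (1.1)] -/
theorem gen_apply (d : Fin (n + 1) → ℝ) (h : ℝ) (v : St V n) :
    gen d h v = diag V n d v - ((h : ℂ) * I) • hopM V n v := rfl

/-- **The dissipation of the generator is the damping**: `Re⟪H v, v⟫ = Σ_k d_k ‖v_k‖²` (the hopping
`i h M` is skew-adjoint and drops out). [cite: ConstantinEtAl2008, §1 eq. (1.1)] -/
theorem re_inner_gen_self (d : Fin (n + 1) → ℝ) (h : ℝ) (v : St V n) :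
    (⟪gen d h v, v⟫_ℂ).re = ∑ k, d k * ‖v k‖ ^ 2 := by
  rw [gen_apply, inner_sub_left, inner_smul_left, inner_diag_self v d, Complex.sub_re, Complex.ofReal_re,
    Complex.mul_re]
  have him := inner_hopM_self_im v
  simp [him]

/-- The same with a spectral shift on the imaginary axis: `Re⟪(H − iμ) v, v⟫ = Σ_k d_k ‖v_k‖²`
(the input shape of resolvent / pseudospectral bounds `‖(H − iμ)v‖ ≥ Ψ‖v‖`).
[cite: Wei2019, Thm 1.3] -/
theorem re_inner_gen_sub_smul_self (d : Fin (n + 1) → ℝ) (h μ : ℝ) (v : St V n) :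
    (⟪gen d h v - ((μ : ℂ) * I) • v, v⟫_ℂ).re = ∑ k, d k * ‖v k‖ ^ 2 := by
  have hw : (⟪v, v⟫_ℂ).im = 0 := by rw [← RCLike.im_to_complex]; exact inner_self_im (𝕜 := ℂ) v
  rw [inner_sub_left, Complex.sub_re, re_inner_gen_self, inner_smul_left, Complex.mul_re, hw]
  simp

/-- **Accretivity**: `0 ≤ Re⟪H v, v⟫` when `d ≥ 0` — the hypothesis `hacc` of the finite-dimensional
Gearhart–Prüss / Wei bound `Literature.Analysis.OperatorTheory.norm_le_exp_pi_mul_of_resolvent_bound`.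
[cite: Wei2019, Thm 1.3] -/
theorem re_inner_gen_self_nonneg {d : Fin (n + 1) → ℝ} (hd : ∀ k, 0 ≤ d k) (h : ℝ) (v : St V n) :
    0 ≤ (⟪gen d h v, v⟫_ℂ).re := by
  rw [re_inner_gen_self]
  exact Finset.sum_nonneg fun k _ => mul_nonneg (hd k) (sq_nonneg _)

/-- **The energy identity** for `u′ = −H u = (i h M − D) u` on `[a, b]` (derivatives within `[a, b]`,
the shape used by `GearhartPrussAccretive`):
`‖u t‖² + 2 ∫ₐᵗ Σ_k d_k ‖u_k(s)‖² ds = ‖u a‖²` for every `t ∈ [a, b]` (no sign condition on `d`).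
[cite: ConstantinEtAl2008, §1 eq. (1.1)] -/
theorem norm_sq_add_two_mul_integral_eq (d : Fin (n + 1) → ℝ) (h : ℝ) {a b : ℝ} {u : ℝ → St V n}
    (hu : ∀ s ∈ Icc a b, HasDerivWithinAt u (-(gen d h (u s))) (Icc a b) s) {t : ℝ} (ht : t ∈ Icc a b) :
    ‖u t‖ ^ 2 + 2 * ∫ s in a..t, (∑ k, d k * ‖u s k‖ ^ 2) = ‖u a‖ ^ 2 := by
  have hcont : ContinuousOn u (Icc a b) := fun s hs => (hu s hs).continuousWithinAt
  have hcont2 : ContinuousOn (fun s => ‖u s‖ ^ 2) (Icc a t) :=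
    ((hcont.norm).pow 2).mono (Icc_subset_Icc_right ht.2)
  -- the derivative of the energy in the interior
  have hderiv : ∀ s ∈ Ioo a t, HasDerivAt (fun s => ‖u s‖ ^ 2) (-2 * ∑ k, d k * ‖u s k‖ ^ 2) s := by
    intro s hs
    have hsI : s ∈ Ioo a b := ⟨hs.1, hs.2.trans_le ht.2⟩
    have hux : HasDerivAt u (-(gen d h (u s))) s :=
      (hu s (Ioo_subset_Icc_self hsI)).hasDerivAt (Icc_mem_nhds hsI.1 hsI.2)
    have h1 := hux.inner ℂ hux
    have h2 : HasDerivAt (fun t => (⟪u t, u t⟫_ℂ).re)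
        ((⟪u s, -(gen d h (u s))⟫_ℂ + ⟪-(gen d h (u s)), u s⟫_ℂ).re) s :=
      (Complex.reCLM.hasFDerivAt.comp_hasDerivAt s h1 :)
    have h3 : (fun t => ‖u t‖ ^ 2) = fun t => (⟪u t, u t⟫_ℂ).re := by
      funext t; rw [← inner_self_eq_norm_sq (𝕜 := ℂ)]; rfl
    rw [h3]
    refine h2.congr_deriv ?_
    rw [Complex.add_re, ← inner_conj_symm (u s) (-(gen d h (u s))), Complex.conj_re, inner_neg_left,
      Complex.neg_re, re_inner_gen_self]
    ring
  -- the dissipation density is continuous on `[a, t]`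
  have hF : ContinuousOn (fun s => ∑ k, d k * ‖u s k‖ ^ 2) (Icc a t) := by
    refine continuousOn_finsetSum _ fun k _ => ?_
    refine (continuousOn_const.mul ((((PiLp.proj 2 (𝕜 := ℂ) (fun _ : Fin (n + 1) => V) k).continuous.comp_continuousOn
      (hcont.mono (Icc_subset_Icc_right ht.2))).norm).pow 2))
  have hFint : IntervalIntegrable (fun s => -2 * ∑ k, d k * ‖u s k‖ ^ 2) volume a t := by
    refine ((continuousOn_const.mul hF).mono ?_).intervalIntegrable
    rw [uIcc_of_le ht.1]
  have hFTC := integral_eq_sub_of_hasDerivAt_of_le ht.1 hcont2 hderiv hFint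
  rw [intervalIntegral.integral_const_mul] at hFTC
  linarith

end Energy

end Ladder

end Literature.Analysis.OperatorTheory
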